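import Summits.KontsevichZagierPeriods.KontsevichZagierPeriods.Theorems.LinRedNormalFormArrangementNormalFormSeparateTwoContract
import Summits.KontsevichZagierPeriods.KontsevichZagierPeriods.Theorems.LinRedNormalFormArrangementNormalFormSeparateTwoAdapters

/-!
# The fibre mass is almost decreasing towards a special corner

(Line `janus-bands`, crux `ArrangementNormalForm`, stub `stub_separateTwoPos`, part `Corner`.)
The weight hypothesis `hmono` of the monomial split (part `MonoSplit`) for the fibre mass, from
the contraction lemma (part `Contract`) and the concrete windows (parts `Window`, `Adapters`).
At a special point of the base plane, in blown-up coordinates `(x, v)` along a rational ray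
(`base point = P + x (e₁ + v e₂)`), every atom in use has the value
`c₀(c) + x (p(c) + q(c) v)` (`c₀` = value at `P`, `p` = slope along the ray, `q` = transversal
slope). Moving towards the corner within ratio `4` in each variable costs a CONSTANT:
`mass(x, v) ≤ 81^{k·#U} · mass(x', v')` for `x ≤ x' ≤ 4x`, `v ≤ v' ≤ 4v` in the range
`x' ≤ G/(28R)`, `v' ≤ min(1, g/(14R))` (`G` = separation of the distinct values at `P`, `g` =
separation of the distinct ray slopes, `R` = bound for the slopes) — `SepTwo.lmass_corner_mono`,
registered as `separateTwo_corner`. Radially this is the contraction of every value cluster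
about its value at `P` by `s = x/x'`, angularly the contraction of every ray sub-cluster about
its value on the ray by `s = v/v'`; with buffer ratio `ρ/ℓ = 2` and `s ≥ 1/4` the window
constant `3 · wexp ℓ ρ s` is at most `9` (`SepTwo.lmass_contract_nine`). No lower bound
("placement") is involved: this is the only fibre-mass input of the monomial split.
-/

noncomputable section

open Set MeasureTheory
open scoped ENNReal

namespace Summit.KontsevichZagierPeriods.ArrangementNormalForm.JanusBands

namespace SepTwo

variable {k : ℕ} {ι : Type*}

/-- The window exponent for buffer ratio `2` and contraction factor `s ≥ 1/4` is at most `3`. -/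
theorem wexp_le_three {ℓ s : ℝ} (hℓ : 0 < ℓ) (hs : 1 / 4 ≤ s) (hs1 : s ≤ 1) :
    wexp ℓ (2 * ℓ) s ≤ 3 := by
  unfold wexp
  have h2 : 2 * ℓ / ℓ = 2 := by field_simp
  rw [h2]
  have hlog2 : 0 < Real.log 2 := Real.log_pos one_lt_two
  have hs0 : 0 < s := by linarith
  have hlogs : -Real.log s ≤ 2 * Real.log 2 := by
    rw [← Real.log_inv]
    have h4 : s⁻¹ ≤ 4 := by
      rw [inv_le_comm₀ hs0 (by norm_num)]
      linarith
    calc Real.log s⁻¹ ≤ Real.log 4 := Real.log_le_log (inv_pos.2 hs0) h4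
      _ = 2 * Real.log 2 := by
        rw [show (4 : ℝ) = 2 ^ 2 by norm_num, Real.log_pow]; norm_num
  have h3 : -Real.log s / Real.log 2 ≤ 2 := by
    rw [div_le_iff₀ hlog2]; linarith
  have h4 : 1 - Real.log s / Real.log 2 = 1 + -Real.log s / Real.log 2 := by ring
  have _h5 : Real.log s ≤ 0 := Real.log_nonpos hs0.le hs1
  rw [h4]
  linarith

/-- **One contraction step with buffer ratio `2` and factor `s ∈ [1/4, 1]`** costs `9^{k·#U}`. -/
theorem lmass_contract_nine (lo hi : Fin k → Fin k ⊕ ι) (a : Fin k → Option ι) (U : Finset ι)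
    (hlo : ∀ i c, lo i = Sum.inr c → c ∈ U) (hhi : ∀ i c, hi i = Sum.inr c → c ∈ U)
    (ha : ∀ i c, a i = some c → c ∈ U) (α α' anc : ι → ℝ) (s ℓ : ℝ)
    (hs : 1 / 4 ≤ s ∧ s ≤ 1) (hℓ : 0 < ℓ)
    (hcore : ∀ c ∈ U, |α c - anc c| ≤ ℓ / 2)
    (hsep : ∀ c ∈ U, ∀ c' ∈ U, anc c ≠ anc c' → 7 * ℓ ≤ |anc c - anc c'|)
    (hcontr : ∀ c ∈ U, α' c = anc c + s * (α c - anc c)) :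
    lmass lo hi a α' ≤ (9 : ℝ≥0∞) ^ (k * U.card) * lmass lo hi a α := by
  have hs0 : 0 < s := by linarith [hs.1]
  have hw1 : 1 ≤ wexp ℓ (2 * ℓ) s := one_le_wexp ⟨hℓ, le_rfl, hs0, hs.2⟩
  have hA1 : (1 : ℝ) ≤ 3 * wexp ℓ (2 * ℓ) s := by linarith
  have hA9 : 3 * wexp ℓ (2 * ℓ) s ≤ 9 := by linarith [wexp_le_three hℓ hs.1 hs.2]
  have hsep' : ∀ c ∈ U, ∀ c' ∈ U, anc c ≠ anc c' → 3 * (2 * ℓ) + ℓ ≤ |anc c - anc c'| :=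
    fun c hc c' hc' hne => by linarith [hsep c hc c' hc' hne]
  have h := lmass_contract lo hi a U hlo hhi ha α α' anc s ℓ (2 * ℓ) (3 * wexp ℓ (2 * ℓ) s) hA1
    ⟨hs0, hs.2⟩ ⟨hℓ, le_rfl⟩ hcore hsep' hcontr (fun m => hwin_of_window hℓ le_rfl hs0 hs.2 m)
  calc lmass lo hi a α' ≤ ENNReal.ofReal (3 * wexp ℓ (2 * ℓ) s) ^ (k * U.card) * lmass lo hi a α := h
    _ ≤ (9 : ℝ≥0∞) ^ (k * U.card) * lmass lo hi a α := by
        gcongr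
        calc ENNReal.ofReal (3 * wexp ℓ (2 * ℓ) s) ≤ ENNReal.ofReal 9 := ENNReal.ofReal_le_ofReal hA9
          _ = 9 := by norm_num

/-- **The fibre mass is almost decreasing towards a special corner.** See the module docstring. -/
theorem lmass_corner_mono (lo hi : Fin k → Fin k ⊕ ι) (a : Fin k → Option ι) (U : Finset ι)
    (hlo : ∀ i c, lo i = Sum.inr c → c ∈ U) (hhi : ∀ i c, hi i = Sum.inr c → c ∈ U)
    (ha : ∀ i c, a i = some c → c ∈ U) (c₀ p q : ι → ℝ) (G g R : ℝ) (hR : 0 < R)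
    (hGsep : ∀ c ∈ U, ∀ c' ∈ U, c₀ c ≠ c₀ c' → G ≤ |c₀ c - c₀ c'|)
    (hgsep : ∀ c ∈ U, ∀ c' ∈ U, p c ≠ p c' → g ≤ |p c - p c'|)
    (hRp : ∀ c ∈ U, |p c| ≤ R) (hRq : ∀ c ∈ U, |q c| ≤ R)
    {x x' v v' : ℝ} (hx : 0 < x) (hxx' : x ≤ x') (hx'x : x' ≤ 4 * x) (hx' : x' ≤ G / (28 * R))
    (hv : 0 < v) (hvv' : v ≤ v') (hv'v : v' ≤ 4 * v) (hv'1 : v' ≤ 1) (hv'g : v' ≤ g / (14 * R)) :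
    lmass lo hi a (fun c => c₀ c + x * (p c + q c * v)) ≤
      (9 : ℝ≥0∞) ^ (k * U.card) * (9 : ℝ≥0∞) ^ (k * U.card) *
        lmass lo hi a (fun c => c₀ c + x' * (p c + q c * v')) := by
  have hx'0 : 0 < x' := lt_of_lt_of_le hx hxx'
  have hv'0 : 0 < v' := lt_of_lt_of_le hv hvv'
  have hG28 : 28 * x' * R ≤ G := by
    have := (le_div_iff₀ (by positivity : (0 : ℝ) < 28 * R)).1 hx'; linarith
  have hg14 : 14 * v' * R ≤ g := by
    have := (le_div_iff₀ (by positivity : (0 : ℝ) < 14 * R)).1 hv'g; linarith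
  -- radial step
  have hrad : lmass lo hi a (fun c => c₀ c + x * (p c + q c * v)) ≤
      (9 : ℝ≥0∞) ^ (k * U.card) * lmass lo hi a (fun c => c₀ c + x' * (p c + q c * v)) := by
    refine lmass_contract_nine lo hi a U hlo hhi ha _ _ c₀ (x / x') (4 * x' * R)
      ⟨?_, (div_le_one hx'0).2 hxx'⟩ (by positivity) ?_ ?_ ?_
    · rw [le_div_iff₀ hx'0]; linarith
    · intro c hc
      have hv1 : |v| ≤ 1 := by rw [abs_of_pos hv]; linarith
      have h1 : |p c + q c * v| ≤ 2 * R := by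
        calc |p c + q c * v| ≤ |p c| + |q c * v| := abs_add_le _ _
          _ = |p c| + |q c| * |v| := by rw [abs_mul]
          _ ≤ R + R * 1 := add_le_add (hRp c hc) (mul_le_mul (hRq c hc) hv1 (abs_nonneg _) hR.le)
          _ = 2 * R := by ring
      rw [show c₀ c + x' * (p c + q c * v) - c₀ c = x' * (p c + q c * v) by ring, abs_mul,
        abs_of_pos hx'0]
      nlinarith
    · intro c hc c' hc' hne
      linarith [hGsep c hc c' hc' hne]
    · intro c _
      rw [show c₀ c + x' * (p c + q c * v) - c₀ c = x' * (p c + q c * v) by ring]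
      field_simp
  -- angular step
  have hang : lmass lo hi a (fun c => c₀ c + x' * (p c + q c * v)) ≤
      (9 : ℝ≥0∞) ^ (k * U.card) * lmass lo hi a (fun c => c₀ c + x' * (p c + q c * v')) := by
    refine lmass_contract_nine lo hi a U hlo hhi ha _ _ (fun c => c₀ c + x' * p c) (v / v')
      (2 * x' * R * v') ⟨?_, (div_le_one hv'0).2 hvv'⟩ (by positivity) ?_ ?_ ?_
    · rw [le_div_iff₀ hv'0]; linarith
    · intro c hc
      rw [show c₀ c + x' * (p c + q c * v') - (c₀ c + x' * p c) = x' * (q c * v') by ring, abs_mul,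
        abs_of_pos hx'0, abs_mul, abs_of_pos hv'0]
      have h1 : |q c| * v' ≤ R * v' := mul_le_mul_of_nonneg_right (hRq c hc) hv'0.le
      nlinarith
    · intro c hc c' hc' hne
      by_cases h0 : c₀ c = c₀ c'
      · have hp : p c ≠ p c' := by
          intro hp; exact hne (by rw [h0, hp])
        rw [show c₀ c + x' * p c - (c₀ c' + x' * p c') = x' * (p c - p c') by rw [h0]; ring, abs_mul,
          abs_of_pos hx'0]
        have h1 := hgsep c hc c' hc' hp
        nlinarith
      · have h1 := hGsep c hc c' hc' h0
        have h2 : |x' * (p c - p c')| ≤ 2 * x' * R := by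
          rw [abs_mul, abs_of_pos hx'0]
          have : |p c - p c'| ≤ R + R := (abs_sub _ _).trans (add_le_add (hRp c hc) (hRp c' hc'))
          nlinarith
        have h3 : |c₀ c - c₀ c'| - |x' * (p c - p c')| ≤ |c₀ c + x' * p c - (c₀ c' + x' * p c')| := by
          have e : c₀ c - c₀ c' = (c₀ c + x' * p c - (c₀ c' + x' * p c')) - x' * (p c - p c') := by
            ring
          have := abs_sub (c₀ c + x' * p c - (c₀ c' + x' * p c')) (x' * (p c - p c'))
          rw [← e] at this
          linarith
        have h4 : v' * R ≤ R := by nlinarith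
        nlinarith
    · intro c _
      rw [show c₀ c + x' * (p c + q c * v') - (c₀ c + x' * p c) = x' * (q c * v') by ring]
      field_simp
      ring
  calc lmass lo hi a (fun c => c₀ c + x * (p c + q c * v))
      ≤ (9 : ℝ≥0∞) ^ (k * U.card) * lmass lo hi a (fun c => c₀ c + x' * (p c + q c * v)) := hrad
    _ ≤ (9 : ℝ≥0∞) ^ (k * U.card) * ((9 : ℝ≥0∞) ^ (k * U.card) *
        lmass lo hi a (fun c => c₀ c + x' * (p c + q c * v'))) := mul_le_mul_right hang _
    _ = _ := by rw [mul_assoc]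

end SepTwo

/-- **The fibre mass is almost decreasing towards a special corner** (registered part of
`stub_separateTwoPos`; literal form of `SepTwo.lmass_corner_mono`): in blown-up coordinates
`(x, v)` at a special point, with atom values `c₀ c + x (p c + q c v)`, moving towards the
corner within ratio `4` in each variable multiplies the fibre mass by at most `81^{k·#U}`, in
the range `x' ≤ G/(28R)`, `v' ≤ min(1, g/(14R))`. This is the hypothesis `hmono` of
`separateTwo_monoSplit` for the fibre-mass weight. -/
theorem separateTwo_corner (k : ℕ) (ι : Type) (lo hi : Fin k → Fin k ⊕ ι) (a : Fin k → Option ι) (U : Finset ι) (hlo : ∀ i c, lo i = Sum.inr c → c ∈ U) (hhi : ∀ i c, hi i = Sum.inr c → c ∈ U) (ha : ∀ i c, a i = some c → c ∈ U) (c₀ p q : ι → ℝ) (G g R : ℝ) (hR : 0 < R) (hGsep : ∀ c ∈ U, ∀ c' ∈ U, c₀ c ≠ c₀ c' → G ≤ |c₀ c - c₀ c'|) (hgsep : ∀ c ∈ U, ∀ c' ∈ U, p c ≠ p c' → g ≤ |p c - p c'|) (hRp : ∀ c ∈ U, |p c| ≤ R) (hRq : ∀ c ∈ U, |q c| ≤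 R) (x x' v v' : ℝ) (hx : 0 < x) (hxx' : x ≤ x') (hx'x : x' ≤ 4 * x) (hx' : x' ≤ G / (28 * R)) (hv : 0 < v) (hvv' : v ≤ v') (hv'v : v' ≤ 4 * v) (hv'1 : v' ≤ 1) (hv'g : v' ≤ g / (14 * R)) : MeasureTheory.lintegral (MeasureTheory.volume.restrict {t : Fin k → ℝ | ∀ i, Sum.elim t (fun c => c₀ c + x * (p c + q c * v)) (lo i) < t i ∧ t i < Sum.elim t (fun c => c₀ c + x * (p c + q c * v)) (hi i)}) (fun t => ∏ i, (a i).elim 1 (fun c => ENNReal.ofReal |t i - (c₀ c + x * (p c + q c * v))|⁻¹)) ≤ (9 : ENNReal) ^ (k * U.card) * (9 : ENNReal) ^ (k * U.card) * MeasureTheory.lintegral (MeasureTheory.volume.restrict {t : Fin k → ℝ | ∀ i, Sum.elim t (fun c => c₀ c + x' * (p c + q c * v')) (lo i) < t i ∧ t i < Sum.elim t (fun c => c₀ c + x' * (p c + q c * v')) (hi i)}) (fun t => ∏ i, (a i).elim 1 (fun c => ENNReal.ofReal |t i - (c₀ c + x' * (p c + q c * v'))|⁻¹)) := by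
  exact SepTwo.lmass_corner_mono lo hi a U hlo hhi ha c₀ p q G g R hR hGsep hgsep hRp hRq hx hxx' hx'x hx' hv hvv' hv'v hv'1 hv'g

end Summit.KontsevichZagierPeriods.ArrangementNormalForm.JanusBands
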